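import Summits.ResolutionOfSingularities.ResolutionOfSingularities.Theorems.ConeChainKernels
import HarnessLib

/-! # ConeChainCells — decomp-res-lens-4 g42 node «ConeChain», FILE D (§147: the CUTS of the doubly-narrow located core C₃♮ʳᶠ♯ᵏ♯ᵉ
`…NarrowCofactorNarrowMixed…` (Theorems/DirectrixCutCells, VERBATIM) by (DF) then (EC) via `noTowerWild_split` (excluded middle exact); the
two KILLS, ABSOLUTE (every `p`, field, weight `n ≥ 1`; port-free, no `MinimalAt`/`h640`): «TRANSVERSAL CONE» (∧ ¬DF) and «FLAG ∧ EC»; the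
NEW LOCATED CORE C₃♮ʳᶠ♯ᵏ♯ᵉᶠ «flagged doubly narrow» `…FlagProperCone…` (UNDECIDED · IDEA-NEEDED, no inhabitant claimed); the exact
re-locations `…_iff_g42` (weight by weight under the floor `1 ≤ n`; BY NAME hypothesis-free) of the core AND of the located residual
(C₃♮ʳᶠ♯ᵏ♯ᵉ ∧ C₄) ∧ D₄ ⟺ (C₃♮ʳᶠ♯ᵏ♯ᵉᶠ ∧ C₄) ∧ D₄; down-links from g36/g39/g41).  VERBATIM slice of HOME/decomp-res-lens-4/g42/ConeChain.lean. -/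


noncomputable section

open CategoryTheory AlgebraicGeometry IsLocalRing TopologicalSpace MvPolynomial
open Literature.AlgebraicGeometry.Resolution
open Summit.ResolutionOfSingularities.ResolutionOfSingularities.Theorems
open WeakOrderReduction ForcedTowerClasses DivergentTowerClasses MonomialTowerClasses
open HugDimensionClasses HugDimensionKernels SurfaceShadowClasses SurfaceShadowKernels
open NearPointCut (SingularClass)
open Scheme.IdealSheafData (vanishingIdeal)

universe u

namespace Summit.ResolutionOfSingularities.ResolutionOfSingularities.Theorems.HugValuationCut

/-! ## ══ FILE D `Theorems/ConeChainCells.lean` (§147; imports FILE C) ══ -/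

/-! ## §147 (g42 · CELLS, CUTS, KILLS, RE-LOCATION) the doubly-narrow core C₃♮ʳᶠ♯ᵏ♯ᵉ (Theorems/DirectrixCutCells :74, VERBATIM, untouched) cut by
(DF), then by (EC); the em-exact splits; the two ABSOLUTE kills; `…_iff_g42`; by-name cells; the located residual -/

section ConeChainCells

variable {k : Type} [Field k]

/-- **SUB-CELL «FLAG» = C₃♮ʳᶠ♯ᵏ♯ᵉ ∧ (DF)**: the doubly-narrow core towers that ARE directrix-flag towers. -/
def WildOccultDivisorialThreefoldNonLineRecurrentCompanionCurveFreeBirthRecurrentCofactorBirthRecurrentNarrowCofactorNarrowFlagMixedWallFreeFreshJumpShallowCompanionKangarooTowersTerminate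
    (n : ℕ) : Prop :=
  NoTowerWild n fun T => (((((((((((MixedResidual n T ∧ ¬ (LatentFactorTower T ∧ ThreefoldTower T)) ∧ ¬ LatentFactorTower T) ∧
    DivisorialTower T) ∧ ThreefoldTower T) ∧ ¬ FollowsLineTower T) ∧ ¬ IsolatedCompanionTower T) ∧ ¬ FollowsCurveTower T) ∧
    ¬ BirthFreeCompanionTower T) ∧
    ¬ BirthFreeCofactorTower T) ∧
    ¬ PlaneConeFreeCompanionTower T) ∧
    ¬ PlaneConeFreeCofactorTower T) ∧
    DirectrixFlagTower n T

/-- **SUB-CELL «TRANSVERSAL CONE» = C₃♮ʳᶠ♯ᵏ♯ᵉ ∧ ¬(DF)**: at some stage a cone plane transversal to the cone line below.  EMPTY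
(LAW B1, absolutely). -/
def WildOccultDivisorialThreefoldNonLineRecurrentCompanionCurveFreeBirthRecurrentCofactorBirthRecurrentNarrowCofactorNarrowTransversalConeMixedWallFreeFreshJumpShallowCompanionKangarooTowersTerminate
    (n : ℕ) : Prop :=
  NoTowerWild n fun T => (((((((((((MixedResidual n T ∧ ¬ (LatentFactorTower T ∧ ThreefoldTower T)) ∧ ¬ LatentFactorTower T) ∧
    DivisorialTower T) ∧ ThreefoldTower T) ∧ ¬ FollowsLineTower T) ∧ ¬ IsolatedCompanionTower T) ∧ ¬ FollowsCurveTower T) ∧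
    ¬ BirthFreeCompanionTower T) ∧
    ¬ BirthFreeCofactorTower T) ∧
    ¬ PlaneConeFreeCompanionTower T) ∧
    ¬ PlaneConeFreeCofactorTower T) ∧
    ¬ DirectrixFlagTower n T

/-- **SUB-CELL «FLAG ∧ EXCEPTIONAL CONE» = C₃♮ʳᶠ♯ᵏ♯ᵉ ∧ (DF) ∧ (EC)**.  EMPTY (LAW B2, absolutely). -/
def WildOccultDivisorialThreefoldNonLineRecurrentCompanionCurveFreeBirthRecurrentCofactorBirthRecurrentNarrowCofactorNarrowFlagExceptionalConeMixedWallFreeFreshJumpShallowCompanionKangarooTowersTerminate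
    (n : ℕ) : Prop :=
  NoTowerWild n fun T => ((((((((((((MixedResidual n T ∧ ¬ (LatentFactorTower T ∧ ThreefoldTower T)) ∧ ¬ LatentFactorTower T) ∧
    DivisorialTower T) ∧ ThreefoldTower T) ∧ ¬ FollowsLineTower T) ∧ ¬ IsolatedCompanionTower T) ∧ ¬ FollowsCurveTower T) ∧
    ¬ BirthFreeCompanionTower T) ∧
    ¬ BirthFreeCofactorTower T) ∧
    ¬ PlaneConeFreeCompanionTower T) ∧
    ¬ PlaneConeFreeCofactorTower T) ∧
    DirectrixFlagTower n T) ∧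
    ExceptionalConeTower n T

/-- **CELL C₃♮ʳᶠ♯ᵏ♯ᵉᶠ · THE LOCATED RESIDUAL CORE after g42 — «THE FLAGGED DOUBLY NARROW TOWER»** = C₃♮ʳᶠ♯ᵏ♯ᵉ ∧ (DF) ∧ ¬(EC): the
doubly-narrow core tower in which, at EVERY stage, the cone plane at `x_{i+1}` contains the tangent line of the cone line `ℓ_i ⊂ E_i`
and is never the exceptional plane `T E_i` — every step is a FLAG STEP `x_{i+1} ∈ ℓ_i ⊂ V(in z)`.  UNDECIDED · IDEA-NEEDED (honest
placement in the NODE header: satellite steps `x_{i+2} = ℓ_i′ ∩ E_{i+1}` vs free steps `x_{i+2} ∈ ℓ_{i+1} ∖ ℓ_i′` are the two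
habitats of the valuative / polygon arguments of CossartPiltant2008 Prop. 4.4 ff. and CossartJannsenSaito2020 Ch. 8–14, both written
with curve centres available; no law on record decides point-only towers here; no certified inhabitant). -/
def WildOccultDivisorialThreefoldNonLineRecurrentCompanionCurveFreeBirthRecurrentCofactorBirthRecurrentNarrowCofactorNarrowFlagProperConeMixedWallFreeFreshJumpShallowCompanionKangarooTowersTerminate
    (n : ℕ) : Prop :=
  NoTowerWild n fun T => ((((((((((((MixedResidual n T ∧ ¬ (LatentFactorTower T ∧ ThreefoldTower T)) ∧ ¬ LatentFactorTower T) ∧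
    DivisorialTower T) ∧ ThreefoldTower T) ∧ ¬ FollowsLineTower T) ∧ ¬ IsolatedCompanionTower T) ∧ ¬ FollowsCurveTower T) ∧
    ¬ BirthFreeCompanionTower T) ∧
    ¬ BirthFreeCofactorTower T) ∧
    ¬ PlaneConeFreeCompanionTower T) ∧
    ¬ PlaneConeFreeCofactorTower T) ∧
    DirectrixFlagTower n T) ∧
    ¬ ExceptionalConeTower n T

/-- **EXACT (pure logic, `noTowerWild_split`): C₃♮ʳᶠ♯ᵏ♯ᵉ = «FLAG» ∧ «TRANSVERSAL CONE»** — the flag cut. [folklore] -/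
theorem wildOccultDivisorialThreefoldNonLineRecurrentCompanionCurveFreeBirthRecurrentCofactorBirthRecurrentNarrowCofactorNarrowMixed_split_flag (n : ℕ) :
    WildOccultDivisorialThreefoldNonLineRecurrentCompanionCurveFreeBirthRecurrentCofactorBirthRecurrentNarrowCofactorNarrowMixedWallFreeFreshJumpShallowCompanionKangarooTowersTerminate n ↔
      WildOccultDivisorialThreefoldNonLineRecurrentCompanionCurveFreeBirthRecurrentCofactorBirthRecurrentNarrowCofactorNarrowFlagMixedWallFreeFreshJumpShallowCompanionKangarooTowersTerminate n ∧
        WildOccultDivisorialThreefoldNonLineRecurrentCompanionCurveFreeBirthRecurrentCofactorBirthRecurrentNarrowCofactorNarrowTransversalConeMixedWallFreeFreshJumpShallowCompanionKangarooTowersTerminate n :=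
  noTowerWild_split _ (DirectrixFlagTower n)

/-- **EXACT (pure logic): «FLAG» = «FLAG ∧ EC» ∧ C₃♮ʳᶠ♯ᵏ♯ᵉᶠ** — the exceptional-cone cut. [folklore] -/
theorem wildOccultDivisorialThreefoldNonLineRecurrentCompanionCurveFreeBirthRecurrentCofactorBirthRecurrentNarrowCofactorNarrowFlagMixed_split_exceptionalCone (n : ℕ) :
    WildOccultDivisorialThreefoldNonLineRecurrentCompanionCurveFreeBirthRecurrentCofactorBirthRecurrentNarrowCofactorNarrowFlagMixedWallFreeFreshJumpShallowCompanionKangarooTowersTerminate n ↔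
      WildOccultDivisorialThreefoldNonLineRecurrentCompanionCurveFreeBirthRecurrentCofactorBirthRecurrentNarrowCofactorNarrowFlagExceptionalConeMixedWallFreeFreshJumpShallowCompanionKangarooTowersTerminate n ∧
        WildOccultDivisorialThreefoldNonLineRecurrentCompanionCurveFreeBirthRecurrentCofactorBirthRecurrentNarrowCofactorNarrowFlagProperConeMixedWallFreeFreshJumpShallowCompanionKangarooTowersTerminate n :=
  noTowerWild_split _ (ExceptionalConeTower n)

/-- **THE FIRST KILL — SUB-CELL «TRANSVERSAL CONE» IS EMPTY, ABSOLUTELY (every `p`, field, weight `n ≥ 1`; port-free, no `MinimalAt`,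
no `SurfaceChainPort`)**: LAW B1 `noTower_threefold_not_directrixFlag` against the cell's ¬(DF). [NEW] -/
theorem wildOccultDivisorialThreefoldNonLineRecurrentCompanionCurveFreeBirthRecurrentCofactorBirthRecurrentNarrowCofactorNarrowTransversalConeMixed_holds (n : ℕ) (hn : 1 ≤ n) :
    WildOccultDivisorialThreefoldNonLineRecurrentCompanionCurveFreeBirthRecurrentCofactorBirthRecurrentNarrowCofactorNarrowTransversalConeMixedWallFreeFreshJumpShallowCompanionKangarooTowersTerminate n := by
  intro p hp _ k _ _ T g hB hD hE hP
  exact noTower_threefold_not_directrixFlag hn (fun _ => True) p hp k T g hB hD hE ⟨trivial, hP.1.1.1.1.1.1.1.1.2, hP.2⟩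

/-- **THE SECOND KILL — SUB-CELL «FLAG ∧ EC» IS EMPTY, ABSOLUTELY**: LAW B2 `noTower_threefold_exceptionalCone` against the cell's (EC).
[NEW] -/
theorem wildOccultDivisorialThreefoldNonLineRecurrentCompanionCurveFreeBirthRecurrentCofactorBirthRecurrentNarrowCofactorNarrowFlagExceptionalConeMixed_holds (n : ℕ) (hn : 1 ≤ n) :
    WildOccultDivisorialThreefoldNonLineRecurrentCompanionCurveFreeBirthRecurrentCofactorBirthRecurrentNarrowCofactorNarrowFlagExceptionalConeMixedWallFreeFreshJumpShallowCompanionKangarooTowersTerminate n := by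
  intro p hp _ k _ _ T g hB hD hE hP
  exact noTower_threefold_exceptionalCone hn (fun _ => True) p hp k T g hB hD hE ⟨trivial, hP.1.1.1.1.1.1.1.1.1.2, hP.2⟩

/-- **EXACT RE-LOCATION OF THE g41 LOCATED CORE, weight by weight (`n ≥ 1`, the cells' own floor; otherwise hypothesis-free):
C₃♮ʳᶠ♯ᵏ♯ᵉ ⟺ C₃♮ʳᶠ♯ᵏ♯ᵉᶠ.** [NEW] -/
theorem wildOccultDivisorialThreefoldNonLineRecurrentCompanionCurveFreeBirthRecurrentCofactorBirthRecurrentNarrowCofactorNarrowMixed_iff_g42 (n : ℕ) (hn : 1 ≤ n) :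
    WildOccultDivisorialThreefoldNonLineRecurrentCompanionCurveFreeBirthRecurrentCofactorBirthRecurrentNarrowCofactorNarrowMixedWallFreeFreshJumpShallowCompanionKangarooTowersTerminate n ↔
      WildOccultDivisorialThreefoldNonLineRecurrentCompanionCurveFreeBirthRecurrentCofactorBirthRecurrentNarrowCofactorNarrowFlagProperConeMixedWallFreeFreshJumpShallowCompanionKangarooTowersTerminate n :=
  ⟨fun h => ((wildOccultDivisorialThreefoldNonLineRecurrentCompanionCurveFreeBirthRecurrentCofactorBirthRecurrentNarrowCofactorNarrowFlagMixed_split_exceptionalCone n).mp ((wildOccultDivisorialThreefoldNonLineRecurrentCompanionCurveFreeBirthRecurrentCofactorBirthRecurrentNarrowCofactorNarrowMixed_split_flag n).mp h).1).2,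
    fun h => (wildOccultDivisorialThreefoldNonLineRecurrentCompanionCurveFreeBirthRecurrentCofactorBirthRecurrentNarrowCofactorNarrowMixed_split_flag n).mpr ⟨(wildOccultDivisorialThreefoldNonLineRecurrentCompanionCurveFreeBirthRecurrentCofactorBirthRecurrentNarrowCofactorNarrowFlagMixed_split_exceptionalCone n).mpr ⟨wildOccultDivisorialThreefoldNonLineRecurrentCompanionCurveFreeBirthRecurrentCofactorBirthRecurrentNarrowCofactorNarrowFlagExceptionalConeMixed_holds n hn, h⟩,
      wildOccultDivisorialThreefoldNonLineRecurrentCompanionCurveFreeBirthRecurrentCofactorBirthRecurrentNarrowCofactorNarrowTransversalConeMixed_holds n hn⟩⟩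

/-- BY NAME: sub-cell «TRANSVERSAL CONE» over all weights (DECIDED, ABSOLUTELY). -/
def NoWildOccultDivisorialThreefoldNonLineRecurrentCompanionCurveFreeBirthRecurrentCofactorBirthRecurrentNarrowCofactorNarrowTransversalConeMixedTowers : Prop :=
  ∀ n : ℕ, 1 ≤ n →
    WildOccultDivisorialThreefoldNonLineRecurrentCompanionCurveFreeBirthRecurrentCofactorBirthRecurrentNarrowCofactorNarrowTransversalConeMixedWallFreeFreshJumpShallowCompanionKangarooTowersTerminate n

/-- BY NAME: sub-cell «FLAG ∧ EC» over all weights (DECIDED, ABSOLUTELY). -/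
def NoWildOccultDivisorialThreefoldNonLineRecurrentCompanionCurveFreeBirthRecurrentCofactorBirthRecurrentNarrowCofactorNarrowFlagExceptionalConeMixedTowers : Prop :=
  ∀ n : ℕ, 1 ≤ n →
    WildOccultDivisorialThreefoldNonLineRecurrentCompanionCurveFreeBirthRecurrentCofactorBirthRecurrentNarrowCofactorNarrowFlagExceptionalConeMixedWallFreeFreshJumpShallowCompanionKangarooTowersTerminate n

/-- BY NAME: sub-cell «FLAG» over all weights. -/
def NoWildOccultDivisorialThreefoldNonLineRecurrentCompanionCurveFreeBirthRecurrentCofactorBirthRecurrentNarrowCofactorNarrowFlagMixedTowers : Prop :=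
  ∀ n : ℕ, 1 ≤ n →
    WildOccultDivisorialThreefoldNonLineRecurrentCompanionCurveFreeBirthRecurrentCofactorBirthRecurrentNarrowCofactorNarrowFlagMixedWallFreeFreshJumpShallowCompanionKangarooTowersTerminate n

/-- BY NAME: **no wild FLAGGED DOUBLY NARROW cofactor-birth-recurrent curve-free occult divisorial threefold tower** (CELL C₃♮ʳᶠ♯ᵏ♯ᵉᶠ;
UNDECIDED — the located residual core after g42). -/
def NoWildOccultDivisorialThreefoldNonLineRecurrentCompanionCurveFreeBirthRecurrentCofactorBirthRecurrentNarrowCofactorNarrowFlagProperConeMixedTowers : Prop :=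
  ∀ n : ℕ, 1 ≤ n →
    WildOccultDivisorialThreefoldNonLineRecurrentCompanionCurveFreeBirthRecurrentCofactorBirthRecurrentNarrowCofactorNarrowFlagProperConeMixedWallFreeFreshJumpShallowCompanionKangarooTowersTerminate n

/-- BY NAME: **THE LOCATED RESIDUAL of the lens-4 NP column after g42** = (C₃♮ʳᶠ♯ᵏ♯ᵉᶠ ∧ C₄) ∧ D₄. -/
def NoWildOccultFlaggedDoublyNarrowCofactorBirthRecurrentCurveFreeCompanionNonLineMixedTowers : Prop :=
  (NoWildOccultDivisorialThreefoldNonLineRecurrentCompanionCurveFreeBirthRecurrentCofactorBirthRecurrentNarrowCofactorNarrowFlagProperConeMixedTowers ∧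
      NoWildOccultDivisorialNonThreefoldMixedTowers) ∧
    NoWildOccultNonDivisorialNonThreefoldMixedTowers

/-- **SUB-CELL «TRANSVERSAL CONE» DECIDED BY NAME — ABSOLUTELY (closed term).** [NEW] -/
theorem noWildOccultDivisorialThreefoldNonLineRecurrentCompanionCurveFreeBirthRecurrentCofactorBirthRecurrentNarrowCofactorNarrowTransversalConeMixedTowers_holds :
    NoWildOccultDivisorialThreefoldNonLineRecurrentCompanionCurveFreeBirthRecurrentCofactorBirthRecurrentNarrowCofactorNarrowTransversalConeMixedTowers := fun n hn =>
  wildOccultDivisorialThreefoldNonLineRecurrentCompanionCurveFreeBirthRecurrentCofactorBirthRecurrentNarrowCofactorNarrowTransversalConeMixed_holds n hn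

/-- **SUB-CELL «FLAG ∧ EC» DECIDED BY NAME — ABSOLUTELY (closed term).** [NEW] -/
theorem noWildOccultDivisorialThreefoldNonLineRecurrentCompanionCurveFreeBirthRecurrentCofactorBirthRecurrentNarrowCofactorNarrowFlagExceptionalConeMixedTowers_holds :
    NoWildOccultDivisorialThreefoldNonLineRecurrentCompanionCurveFreeBirthRecurrentCofactorBirthRecurrentNarrowCofactorNarrowFlagExceptionalConeMixedTowers := fun n hn =>
  wildOccultDivisorialThreefoldNonLineRecurrentCompanionCurveFreeBirthRecurrentCofactorBirthRecurrentNarrowCofactorNarrowFlagExceptionalConeMixed_holds n hn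

/-- **EXACT RE-LOCATION BY NAME, HYPOTHESIS-FREE: CELL C₃♮ʳᶠ♯ᵏ♯ᵉ ⟺ CELL C₃♮ʳᶠ♯ᵏ♯ᵉᶠ.** [NEW] -/
theorem noWildOccultDivisorialThreefoldNonLineRecurrentCompanionCurveFreeBirthRecurrentCofactorBirthRecurrentNarrowCofactorNarrowMixedTowers_iff_g42 :
    NoWildOccultDivisorialThreefoldNonLineRecurrentCompanionCurveFreeBirthRecurrentCofactorBirthRecurrentNarrowCofactorNarrowMixedTowers ↔
      NoWildOccultDivisorialThreefoldNonLineRecurrentCompanionCurveFreeBirthRecurrentCofactorBirthRecurrentNarrowCofactorNarrowFlagProperConeMixedTowers :=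
  ⟨fun h n hn => (wildOccultDivisorialThreefoldNonLineRecurrentCompanionCurveFreeBirthRecurrentCofactorBirthRecurrentNarrowCofactorNarrowMixed_iff_g42 n hn).mp (h n hn), fun h n hn => (wildOccultDivisorialThreefoldNonLineRecurrentCompanionCurveFreeBirthRecurrentCofactorBirthRecurrentNarrowCofactorNarrowMixed_iff_g42 n hn).mpr (h n hn)⟩

/-- **EXACT RE-LOCATION BY NAME, HYPOTHESIS-FREE: the g41 located residual ⟺ the g42 located residual.** [NEW] -/
theorem noWildOccultDoublyNarrowCofactorBirthRecurrentCurveFreeCompanionNonLineMixedTowers_iff_g42 :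
    NoWildOccultDoublyNarrowCofactorBirthRecurrentCurveFreeCompanionNonLineMixedTowers ↔ NoWildOccultFlaggedDoublyNarrowCofactorBirthRecurrentCurveFreeCompanionNonLineMixedTowers := by
  unfold NoWildOccultDoublyNarrowCofactorBirthRecurrentCurveFreeCompanionNonLineMixedTowers NoWildOccultFlaggedDoublyNarrowCofactorBirthRecurrentCurveFreeCompanionNonLineMixedTowers
  rw [noWildOccultDivisorialThreefoldNonLineRecurrentCompanionCurveFreeBirthRecurrentCofactorBirthRecurrentNarrowCofactorNarrowMixedTowers_iff_g42]

/-- down-link (HYPOTHESIS-FREE): the g42 located residual ⟸ the g41 located residual. [folklore] -/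
theorem noWildOccultFlaggedDoublyNarrowCofactorBirthRecurrentCurveFreeCompanionNonLineMixedTowers_of_g41
    (h : NoWildOccultDoublyNarrowCofactorBirthRecurrentCurveFreeCompanionNonLineMixedTowers) : NoWildOccultFlaggedDoublyNarrowCofactorBirthRecurrentCurveFreeCompanionNonLineMixedTowers :=
  noWildOccultDoublyNarrowCofactorBirthRecurrentCurveFreeCompanionNonLineMixedTowers_iff_g42.mp h

/-- up-link (HYPOTHESIS-FREE): the g42 located residual ⟹ the g41 located residual (the cut loses nothing). [folklore] -/
theorem noWildOccultDoublyNarrowCofactorBirthRecurrentCurveFreeCompanionNonLineMixedTowers_of_g42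
    (h : NoWildOccultFlaggedDoublyNarrowCofactorBirthRecurrentCurveFreeCompanionNonLineMixedTowers) : NoWildOccultDoublyNarrowCofactorBirthRecurrentCurveFreeCompanionNonLineMixedTowers :=
  noWildOccultDoublyNarrowCofactorBirthRecurrentCurveFreeCompanionNonLineMixedTowers_iff_g42.mpr h

/-- down-link (HYPOTHESIS-FREE): the g42 located residual ⟸ the g39 located residual. [folklore] -/
theorem noWildOccultFlaggedDoublyNarrowCofactorBirthRecurrentCurveFreeCompanionNonLineMixedTowers_of_g39
    (h : NoWildOccultCofactorBirthRecurrentCurveFreeCompanionNonLineMixedTowers) : NoWildOccultFlaggedDoublyNarrowCofactorBirthRecurrentCurveFreeCompanionNonLineMixedTowers :=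
  noWildOccultFlaggedDoublyNarrowCofactorBirthRecurrentCurveFreeCompanionNonLineMixedTowers_of_g41 (noWildOccultDoublyNarrowCofactorBirthRecurrentCurveFreeCompanionNonLineMixedTowers_of_g39 h)

/-- down-link (HYPOTHESIS-FREE): the g42 located residual ⟸ the g36 located residual. [folklore] -/
theorem noWildOccultFlaggedDoublyNarrowCofactorBirthRecurrentCurveFreeCompanionNonLineMixedTowers_of_g36
    (h : NoWildOccultRecurrentCompanionNonLineMixedTowers) : NoWildOccultFlaggedDoublyNarrowCofactorBirthRecurrentCurveFreeCompanionNonLineMixedTowers :=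
  noWildOccultFlaggedDoublyNarrowCofactorBirthRecurrentCurveFreeCompanionNonLineMixedTowers_of_g41 (noWildOccultDoublyNarrowCofactorBirthRecurrentCurveFreeCompanionNonLineMixedTowers_of_g36 h)

end ConeChainCells

end Summit.ResolutionOfSingularities.ResolutionOfSingularities.Theorems.HugValuationCut
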